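import Summits.ABC.IUTFork.DAGL5a
import Summits.ABC.IUTFork.DAGL5b
import Summits.ABC.IUTFork.DAGL5c
import Summits.ABC.IUTFork.DAGL5p
import Summits.ABC.IUTFork.DAGL5q
import Summits.ABC.IUTFork.DAGL5r
import Summits.ABC.IUTFork.DAGL5s
import Summits.ABC.IUTFork.DAGL5t
import Summits.ABC.IUTFork.DAGL5u
import Summits.ABC.IUTFork.DAGL5v
import Summits.ABC.IUTFork.DAGL5w
import Summits.ABC.IUTFork.DAGL5x
import Summits.ABC.IUTFork.DAGUa
import Summits.ABC.IUTFork.DAGUb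
import Literature.IUT.HodgeTheaters.TemperedCoveringsCor23iiiOfSpecialFibre
import Literature.IUT.HodgeTheaters.StableCurveTemperedDataOfSpecialFibreCor25
import Literature.IUT.HodgeTheaters.TemperedCoveringsSubgraphClosures
import Literature.IUT.HodgeTheaters.TemperedCoveringsCuspidalInertia
import Literature.IUT.HodgeTheaters.PMBaseNegCompatSub
import Literature.IUT.HodgeTheaters.PMBaseNegCompatSyncProofs
import Literature.IUT.HodgeTheaters.PMBaseDischarge
import Literature.IUT.HodgeTheaters.KitCoreThetaBridge
import Literature.IUT.HodgeTheaters.HodgeTheaterModelFKitCor56iLaws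
import Literature.IUT.HodgeTheaters.FKitCoreBridge

/-!
# Layer-5 certificate `Conditional/Layer5OfS` — [IUTchI] Hodge theaters (abc-iut cell; director-abc (C2), RULINGS #35 (1))

**cert L5 v0: CONE 28 (law / merge-atom binders) + 8 datum side-conditions = 36 explicit Prop binders · FACT 0; nodes 139 (claim-proved 47
[_holds 47] · data 56 [index name 50 + no-kernel-id 6] · held/pending 36 [conjoined at the genuine datum or over a named data atom 14 ·
not typable at v0 / settled as typed / deferred to the additive module 22]).**  COUNTING CONVENTION: the top theorem `layer5_of_S` has NO explicit
binder — the held rows' binders sit INSIDE its conjuncts as Π-types (`StatementOf @layer5_held_…`); the 28 LAW binders are L5's scoreboard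
entries; the 8 datum side-conditions (`h36 hsub hne hprime hp hle` of the §2 datum, `hl : l ≠ 2`, `hl : Odd l`) are Prop-typed parameters of the
DATA, listed so that a mechanical scan of explicit Prop binders (36) and this census cannot disagree.
S-FREE: no [IUTchI] node consumes S (`Cor312.PilotKummerIndRelated`); there is no `hS` binder (plan/C/ABC-OF-S-SPEC §3 deviation,
flagged by abc-iut-L5-lead).  FACT-LIST binders: none (no closer below consumes a FACT-LIST row by name).

Mochizuki, *Inter-universal Teichmüller theory I: construction of Hodge theaters*, kurims manuscript (May 2020) [cite: Mochizuki2012]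
(D-0012 claim key; series status DISPUTED).  HONEST FRAMING: nothing in this certificate asserts that abc is proved or refuted or takes a side on [IUTchIII] Cor. 3.12 (nor on [IUTchI]); a binder is an ASSUMPTION LABEL, not an endorsement; typed ≠ discharged; indexed ≠ endorsed; establishment = OUR kernel check only.

WHAT THIS FILE IS (plan/L5/LAYER5-CERT-SPEC.md v0; plan/C/ABC-OF-S-SPEC.md §3): a PROOF-ONLY packaging (no `def`, no `instance`, no
`axiom`, no `sorry`, no notation) of the L5 slice of the [IUTchIII] Cor. 3.12 cone — the 139 [IUTchI] rows of
plan/L5/CONE-L5-STATUS.tsv (= plan/L5/LAYER5-CERT-NODES.tsv, plan/DAG.tsv order) — over the kernel index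
`Summits/ABC/IUTFork/DAGL5{a,b,c,p,q,r,s,t,u,v,w,x}.lean` + witness upgrades `DAGUa/DAGUb.lean` (abc-iut-c312-2).  Four idioms only:
* (a) DISCHARGED claim nodes (47): conjunct `DAG.N_IUTchI_<id>` BY NAME, proof `DAG.N_IUTchI_<id>_holds` BY NAME — `layer5_discharged_sec3…6`.
* (b)/(e) DATA nodes (56; definitions / structures / containers, the index name is an `abbrev` to a non-Prop): no conjunct;
  the kernel name-checks `example := @…` live in the companion `Conditional/Layer5OfSData.lean` (one per row; 6 rows without an
  index name at this regeneration cite their underlying declaration; KNIT requested from abc-iut-c312-2).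
* (c)/(d) HELD rows CONJOINED (14): DATA binders (the genuine 𝔛-datum `StableCurveTemperedData.ofSpecialFibre …` of
  abc-iut-L5-t11, resp. NAMED INTERFACE DATA ATOMS where the genuine object is not yet a term) + explicit LAW / merge-atom binders
  BY NAME + the CLOSED node statement obtained by applying the landed closer — `layer5_held_sec2` (Cor2.3(i)–(vi), Cor2.5; +
  Prop2.4(iii) at the datum, lead D2), `layer5_held_sec6` (Prop6.5(i), 6.6(ii), 6.6(iii), 6.8(i)), `layer5_held_prop67`,
  `layer5_held_cor56i` here, and `layer5_held_cor12` in the companion module `Conditional/Layer5OfSData.lean` (no import between the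
  two modules, so that neither waits on the other's olean).  NODE RULE #17 (abc-iut-L5-lead): an implication-form theorem (`…_of_laws`,
  `DAG.N_…_part`) is NEVER cited as the discharge of a held node; no held row below uses `N_<id>_part`.
* held rows NOT conjoined at v0 (22) — counted and named here, never hidden:
  - IUTchI:Ex3.2(i)–(vi) [6]: after-merge «one verifies» schema (tempered Frobenioid at v ∈ 𝕍^bad over abc-iut-L5-t2's interface
    Ex32*/HodgeTheaterModel): the printed clauses become obligations only at the L1/L2/L3 merge instantiation — no typed closed statement at a genuine
    object exists tonight (witness/consistency files p411799 abc-iut-w4-d047); owner L5-lead:after-merge.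
  - IUTchI:Ex3.3(i)–(iii) [3]: after-merge schema over `GoodLocalFrobenioidOfKit`/`…OfGalois` (abc-iut-L5-t2 g3 merge chain + SUBDAG-IUTchI-Ex33-Ex34
    rows a–e): (iii)(b)(c) are DISCHARGED AT THE PRINTED OBJECT (p417494, p419963 `InitialThetaData.basesFromC_goodLocalFrobenioid{OfEmb,,At}`),
    (iii)(a) `ddashFromD_goodLocalFrobenioidAt_of_geomTFG` (p427137/p427236, abc-iut-w4-d047) is CONDITIONAL on FACT F-0007 `PreservesGeom` — the node's
    residual is the sub-DAG's, not a single closed Prop; owner L5-t2 lineage / w5-d096 index.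
  - IUTchI:Ex4.4(i)(ii), Ex4.5(i) [3]: after-merge schema (model 𝒟-Θ-bridges / 𝒟-NF-bridges over abc-iut-L5-t3's BaseThetaDatum, BaseBridgeModels
    p405606/p411759): the landed model theorems carry `N_…_part` (unconditional label combinatorics) which is NOT the merge obligation and is NOT cited
    as a discharge (NODE RULE #17); owner L5-lead:after-merge.
  - IUTchI:Ex5.4(iv) [1]: after-merge schema: the ∞κ-compatibility clause p.149 ll.1–2 of the model Θ-bridges and NF-bridges (abc-iut-w4-d062
    reading); no kernel-index name; owner L5-lead:after-merge.
  - IUTchI:Ex5.1(i), (v) [2]: typable in class (c) (holder abc-iut-w5-d110 g4, probe CertL5Ex51Probe 308c030026cb1f8e, farm rc 0): 17 data atoms · 1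
    FACT (F-2571 `NFBridgeRecon.MκIsInvariants`) · 21 law binders ⊢ 8 conjuncts (closers p424116 `…existsUniqueCoricStructure_infκ(x)Pair_of_divisors`,
    p424820 `UniqueCyclotomeIso.of_laws`, p427568 `UniqueCyclotomeIsoFamily.of_integral_laws` / p429289 `…of_valuation`, p413972, p407751); NOT
    conjoined in v0 by size/sequencing choice (abc-iut-L5-lead RULINGS #40 (1)(b) = (E1)) — conjoined in the ADDITIVE module
    `Conditional/Layer5OfSEx51.lean` (v0.1, author-of-record abc-iut-w5-d110, ends with `layer5_of_S_v1`; CONE +21 · FACT +1); (i) is a DATA node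
    (`N_IUTchI_Ex5_1_i`, companion) whose printed claims are the FROZEN FACT-LIST predicates F-2571…F-2574.
  - IUTchI:Cor5.3(i)–(iv) [4]: SETTLED AS TYPED (abc-iut-L5-lead): model case PROVED + interface-independence (abc-iut-L5-d4:
    `PMBaseKit.FKit.isomFtoDBijective_of_model` / `exists_fkit_not_isomFtoDBijective`, `S5GlobalLocal.isomGlobalToBaseBijective_of_model` /
    `exists_not_isomGlobalToBaseBijective`, p411013/p409092/p409526/p409894); the kit-level predicates `FKit.IsomFtoDBijective`,
    `FKit.AutTemperedBijective`, `S5GlobalLocal.IsomGlobalToBaseBijective` enter the held theorems below BY NAME as binders (h53ii/h53iv) where a closer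
    consumes them; no conjunct of their own (their universal closures are refuted in tree).
  - IUTchI:Ex5.4(vi)(vii) [2]: SETTLED AS TYPED: inhabitant + counter-instance p412217 (abc-iut-w4-d071 `FrobenioidBridgeModelsEx54viIndependence` /
    `…Schema`); universal closure refuted; no conjunct.
  - IUTchI:Cor5.6(ii) [1]: SETTLED AS TYPED: the Hodge-theater-level reading `Cor56ii_HT` is REFUTED (`BaseThetaDatum.S5Local.not_cor56ii_HT`, p411694
    abc-iut-L5-t3 g2) and the repaired reading `Cor56ii_HTR` is PROVED from Cor 5.3 (i) by name (`cor56ii_HTR_of_baseGIso_bijective`); a refuted closed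
    Prop must not appear under any binder (it would make the certificate vacuous) — no conjunct.

BINDER CENSUS (distinct Prop binders; a binder feeding several conjuncts counts once; data binders / instance atoms not counted):
`layer5_held_sec2` 13 (h22 · hH · hker · hOutTp · hOutHat · hcof · hA · hB · hv · htp · hhat · h24i · h24ii; the DATA binder
`x` = «a cusp of X» also supplies «X has a closed point»; `J` is the data of the level family) · `layer5_held_sec6` 1 (hβ; `hl : l ≠ 2` is a
side condition of the (α)⇐(β) step, counted 0) · `layer5_held_prop67` 1 (hγ) · `layer5_held_cor56i` 7 (he · h02 · h53ii · h53iv · hfaith · hnat · hcan) ·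
`layer5_held_cor12` 6 (h · h' · hR · hR' · hX · hC) = 28.  DATA ATOMS named (genuine object absent from the tree tonight): `K : PMBaseKit l`
(§6; the genuine kit of the D13 P5-binding is in flight — abc-iut-L5-t4 PiAvatar*, abc-iut-L5-t3 KitNFSide*; label slots + the bad-`v` datum
GAP G-L5t4g3-2 (iii) missing), `𝔡 / K / c : KitCore / M` (Prop6.7), `S : S5Local 𝔡 / c / FK / fc : S.FKitCore c FK` (Cor5.6(i); the genuine
Ex 3.5 `Glob` + `ComponentIsoInjective` there is abc-iut-w5-d217's theorem target), `D D' : PuncturedEllipticData` (Cor1.2; no constructor from a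
curve in the tree).  Post-freeze-additive / recent proof-only modules imported for closers (not cone members):
  TemperedCoveringsCor23iiiOfSpecialFibre (p425864, abc-iut-w4-d058, proof-only);
  StableCurveTemperedDataOfSpecialFibreCor25 (p427148, abc-iut-L5-t11, proof-only) over StableCurveTemperedDataOfSpecialFibre (p425343, def-bearing bridge, DEFINITION FROZEN by ref-s);
  HodgeTheaterModelFKitCor56iLaws (p424893, abc-iut-w5-d217, 4 Prop defs, post-freeze additive) + FKitCoreBridge (p417964);
  PMBaseNegCompatSyncProofs (p420660, proof-only), KitCoreThetaBridge (p417112) — pre-freeze;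
all other imports are the kernel index parts.  Every later version only REMOVES binders (law instance PROVED in tree) or SPLITS one
into strictly weaker named ones; it never adds an unnamed hypothesis.  Writer: abc-iut-L5-d2 (gen 6); second readers abc-iut-L5-t16 g5
((a)(b)(e)) and abc-iut-L5-d5 g5 ((c)(d) + counts); §6 reading by abc-iut-L5-t13 g3.
-/

namespace Summit.ABC.IUTFork.Conditional

open scoped Pointwise
open CategoryTheory Topology
open Summit.ABC.IUTFork.DAG.PartL5a (StatementOf)
open Literature.IUT.HodgeTheaters Literature.AnabelianGeometry.SemiGraphs

/-- **Class (a), [IUTchI] §3 Θ-Hodge theaters — the 5 DISCHARGED claim nodes** (DAG.tsv order): each conjunct is the kernel-index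
Prop `DAG.N_IUTchI_<id>` BY NAME, proved by the index witness `DAG.N_IUTchI_<id>_holds` BY NAME (DAGL5 parts / DAGUa / DAGUb); proves
nothing new.  Nodes: Def3.1, Def3.6, Cor3.7(i), Cor3.7(ii), Cor3.7(iii).
Nothing here asserts that abc is proved or refuted or takes a side on [IUTchIII] Cor. 3.12; typed ≠ discharged. -/
theorem layer5_discharged_sec3 :
    DAG.N_IUTchI_Def3_1 ∧  -- IUTchI:Def3.1
    DAG.N_IUTchI_Def3_6 ∧  -- IUTchI:Def3.6
    DAG.N_IUTchI_Cor3_7_i ∧  -- IUTchI:Cor3.7(i)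
    DAG.N_IUTchI_Cor3_7_ii ∧  -- IUTchI:Cor3.7(ii)
    DAG.N_IUTchI_Cor3_7_iii :=  -- IUTchI:Cor3.7(iii)
  ⟨DAG.N_IUTchI_Def3_1_holds, DAG.N_IUTchI_Def3_6_holds, DAG.N_IUTchI_Cor3_7_i_holds, DAG.N_IUTchI_Cor3_7_ii_holds,
    DAG.N_IUTchI_Cor3_7_iii_holds⟩

/-- **Class (a), [IUTchI] §4 Multiplicative combinatorial Teichmüller theory — the 19 DISCHARGED claim nodes** (DAG.tsv order): each conjunct is the kernel-index
Prop `DAG.N_IUTchI_<id>` BY NAME, proved by the index witness `DAG.N_IUTchI_<id>_holds` BY NAME (DAGL5 parts / DAGUa / DAGUb); proves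
nothing new.  Nodes: Def4.1(i), Def4.1(iv), Def4.1(v), Prop4.2, Ex4.3(i), Ex4.3(iv), Ex4.4(iii), Ex4.4(iv), Ex4.5(ii), Prop4.7(i), Prop4.8(ii), Prop4.9(i), Prop4.9(ii), Prop4.9(iii), Prop4.11(i), Prop4.11(ii), Cor4.12(i), Cor4.12(ii), Cor4.12(iii).
Nothing here asserts that abc is proved or refuted or takes a side on [IUTchIII] Cor. 3.12; typed ≠ discharged. -/
theorem layer5_discharged_sec4 :
    DAG.N_IUTchI_Def4_1_i ∧  -- IUTchI:Def4.1(i)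
    DAG.N_IUTchI_Def4_1_iv ∧  -- IUTchI:Def4.1(iv)
    DAG.N_IUTchI_Def4_1_v ∧  -- IUTchI:Def4.1(v)
    DAG.N_IUTchI_Prop4_2 ∧  -- IUTchI:Prop4.2
    DAG.N_IUTchI_Ex4_3_i ∧  -- IUTchI:Ex4.3(i)
    DAG.N_IUTchI_Ex4_3_iv ∧  -- IUTchI:Ex4.3(iv)
    DAG.N_IUTchI_Ex4_4_iii ∧  -- IUTchI:Ex4.4(iii)
    DAG.N_IUTchI_Ex4_4_iv ∧  -- IUTchI:Ex4.4(iv)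
    DAG.N_IUTchI_Ex4_5_ii ∧  -- IUTchI:Ex4.5(ii)
    DAG.N_IUTchI_Prop4_7_i ∧  -- IUTchI:Prop4.7(i)
    DAG.N_IUTchI_Prop4_8_ii ∧  -- IUTchI:Prop4.8(ii)
    DAG.N_IUTchI_Prop4_9_i ∧  -- IUTchI:Prop4.9(i)
    DAG.N_IUTchI_Prop4_9_ii ∧  -- IUTchI:Prop4.9(ii)
    DAG.N_IUTchI_Prop4_9_iii ∧  -- IUTchI:Prop4.9(iii)
    DAG.N_IUTchI_Prop4_11_i ∧  -- IUTchI:Prop4.11(i)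
    DAG.N_IUTchI_Prop4_11_ii ∧  -- IUTchI:Prop4.11(ii)
    DAG.N_IUTchI_Cor4_12_i ∧  -- IUTchI:Cor4.12(i)
    DAG.N_IUTchI_Cor4_12_ii ∧  -- IUTchI:Cor4.12(ii)
    DAG.N_IUTchI_Cor4_12_iii :=  -- IUTchI:Cor4.12(iii)
  ⟨DAG.N_IUTchI_Def4_1_i_holds, DAG.N_IUTchI_Def4_1_iv_holds, DAG.N_IUTchI_Def4_1_v_holds, DAG.N_IUTchI_Prop4_2_holds,
    DAG.N_IUTchI_Ex4_3_i_holds, DAG.N_IUTchI_Ex4_3_iv_holds, DAG.N_IUTchI_Ex4_4_iii_holds, DAG.N_IUTchI_Ex4_4_iv_holds,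
    DAG.N_IUTchI_Ex4_5_ii_holds, DAG.N_IUTchI_Prop4_7_i_holds, DAG.N_IUTchI_Prop4_8_ii_holds,
    DAG.N_IUTchI_Prop4_9_i_holds, DAG.N_IUTchI_Prop4_9_ii_holds, DAG.N_IUTchI_Prop4_9_iii_holds,
    DAG.N_IUTchI_Prop4_11_i_holds, DAG.N_IUTchI_Prop4_11_ii_holds, DAG.N_IUTchI_Cor4_12_i_holds,
    DAG.N_IUTchI_Cor4_12_ii_holds, DAG.N_IUTchI_Cor4_12_iii_holds⟩

/-- **Class (a), [IUTchI] §5 ΘNF-Hodge theaters — the 4 DISCHARGED claim nodes** (DAG.tsv order): each conjunct is the kernel-index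
Prop `DAG.N_IUTchI_<id>` BY NAME, proved by the index witness `DAG.N_IUTchI_<id>_holds` BY NAME (DAGL5 parts / DAGUa / DAGUb); proves
nothing new.  Nodes: Ex5.1(iii), Ex5.1(iv), Ex5.1(vii), Ex5.4(iii).
Nothing here asserts that abc is proved or refuted or takes a side on [IUTchIII] Cor. 3.12; typed ≠ discharged. -/
theorem layer5_discharged_sec5 :
    DAG.N_IUTchI_Ex5_1_iii ∧  -- IUTchI:Ex5.1(iii)
    DAG.N_IUTchI_Ex5_1_iv ∧  -- IUTchI:Ex5.1(iv)
    DAG.N_IUTchI_Ex5_1_vii ∧  -- IUTchI:Ex5.1(vii)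
    DAG.N_IUTchI_Ex5_4_iii :=  -- IUTchI:Ex5.4(iii)
  ⟨DAG.N_IUTchI_Ex5_1_iii_holds, DAG.N_IUTchI_Ex5_1_iv_holds, DAG.N_IUTchI_Ex5_1_vii_holds,
    DAG.N_IUTchI_Ex5_4_iii_holds⟩

/-- **Class (a), [IUTchI] §6 Additive combinatorial Teichmüller theory — the 19 DISCHARGED claim nodes** (DAG.tsv order): each conjunct is the kernel-index
Prop `DAG.N_IUTchI_<id>` BY NAME, proved by the index witness `DAG.N_IUTchI_<id>_holds` BY NAME (DAGL5 parts / DAGUa / DAGUb); proves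
nothing new.  Nodes: Def6.1(i), Def6.1(iii), Def6.1(iv), Ex6.2(ii), Ex6.2(iii), Def6.4(i), Def6.4(ii), Def6.4(iii), Prop6.5(ii), Prop6.5(iv), Prop6.8(ii), Prop6.8(iii), Prop6.9(i), Prop6.9(ii), Cor6.10(i), Cor6.10(ii), Cor6.10(iii), Def6.11(i), Def6.11(ii).
Nothing here asserts that abc is proved or refuted or takes a side on [IUTchIII] Cor. 3.12; typed ≠ discharged. -/
theorem layer5_discharged_sec6 :
    DAG.N_IUTchI_Def6_1_i ∧  -- IUTchI:Def6.1(i)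
    DAG.N_IUTchI_Def6_1_iii ∧  -- IUTchI:Def6.1(iii)
    DAG.N_IUTchI_Def6_1_iv ∧  -- IUTchI:Def6.1(iv)
    DAG.N_IUTchI_Ex6_2_ii ∧  -- IUTchI:Ex6.2(ii)
    DAG.N_IUTchI_Ex6_2_iii ∧  -- IUTchI:Ex6.2(iii)
    DAG.N_IUTchI_Def6_4_i ∧  -- IUTchI:Def6.4(i)
    DAG.N_IUTchI_Def6_4_ii ∧  -- IUTchI:Def6.4(ii)
    DAG.N_IUTchI_Def6_4_iii ∧  -- IUTchI:Def6.4(iii)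
    DAG.N_IUTchI_Prop6_5_ii ∧  -- IUTchI:Prop6.5(ii)
    DAG.N_IUTchI_Prop6_5_iv ∧  -- IUTchI:Prop6.5(iv)
    DAG.N_IUTchI_Prop6_8_ii ∧  -- IUTchI:Prop6.8(ii)
    DAG.N_IUTchI_Prop6_8_iii ∧  -- IUTchI:Prop6.8(iii)
    DAG.N_IUTchI_Prop6_9_i ∧  -- IUTchI:Prop6.9(i)
    DAG.N_IUTchI_Prop6_9_ii ∧  -- IUTchI:Prop6.9(ii)
    DAG.N_IUTchI_Cor6_10_i ∧  -- IUTchI:Cor6.10(i)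
    DAG.N_IUTchI_Cor6_10_ii ∧  -- IUTchI:Cor6.10(ii)
    DAG.N_IUTchI_Cor6_10_iii ∧  -- IUTchI:Cor6.10(iii)
    DAG.N_IUTchI_Def6_11_i ∧  -- IUTchI:Def6.11(i)
    DAG.N_IUTchI_Def6_11_ii :=  -- IUTchI:Def6.11(ii)
  ⟨DAG.N_IUTchI_Def6_1_i_holds, DAG.N_IUTchI_Def6_1_iii_holds, DAG.N_IUTchI_Def6_1_iv_holds,
    DAG.N_IUTchI_Ex6_2_ii_holds, DAG.N_IUTchI_Ex6_2_iii_holds, DAG.N_IUTchI_Def6_4_i_holds, DAG.N_IUTchI_Def6_4_ii_holds,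
    DAG.N_IUTchI_Def6_4_iii_holds, DAG.N_IUTchI_Prop6_5_ii_holds, DAG.N_IUTchI_Prop6_5_iv_holds,
    DAG.N_IUTchI_Prop6_8_ii_holds, DAG.N_IUTchI_Prop6_8_iii_holds, DAG.N_IUTchI_Prop6_9_i_holds,
    DAG.N_IUTchI_Prop6_9_ii_holds, DAG.N_IUTchI_Cor6_10_i_holds, DAG.N_IUTchI_Cor6_10_ii_holds,
    DAG.N_IUTchI_Cor6_10_iii_holds, DAG.N_IUTchI_Def6_11_i_holds, DAG.N_IUTchI_Def6_11_ii_holds⟩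

/-- **Class (c)/(d), [IUTchI] §2 — HELD rows Cor 2.3 (i)–(vi), Cor 2.5 (and Prop 2.4 (iii), lead D2) CLOSED at the GENUINE 𝔛-datum**
`StableCurveTemperedData.ofSpecialFibre X d S h36 Sigma SigmaHat hsub hne hprime hp TpH HatH hle cuspMeetsH` (abc-iut-L5-t11's bridge p425343 from a tempered curve
`X : TemperedCurve p` of the [SemiAnbd] §6 interface with group-level data `d` and special-fibre data `S`, [SemiAnbd] Ex. 3.10).
DATA binders: the datum's parameters and a cusp `x` of `X` (supplying «`X` has a closed point and a cusp»).  PROP binders = merge atoms /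
held inputs BY NAME: `h22` Prop 2.2 for the special-fibre 𝔾-data · `hH`, `hker` the two density facts of Cor 2.3 (ii) · `hOutTp`,
`hOutHat` the outer-descent atoms of (i) · `J`/`hcof`/`hA`/`hB` the `ℍ`-free KER-LEVEL conclusions of the printed proof of (iii) over a
cofinal tower of normal open `J ⊆ Δ̂_X` (GAP G-w4d058-1; reducible per level to the printed inputs by
`mem_level_of_comm_ker_of_inputs`) · `hv` the 𝔾-level «`Π̂_ℍ ∩ Π^tp_𝔾 = Π^tp_ℍ`» of (v) · `htp`/`hhat` the two 𝔾-level incidence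
directions of (vi) (`cuspMeetsH` stays the abstract printed atom (vi)(b)) · `h24i`/`h24ii` Prop 2.4 (i)/(ii) at the datum (HELD nodes,
typed predicates).  Closers BY NAME: `cor23_i_to_iv_ofSpecialFibre` (abc-iut-w4-d058; topological side conditions and `Z(G_k) = 1`
DISCHARGED there), `cor23v_of_graph` (abc-iut-L5-d4), `cor23vi_of_graph` (abc-iut-L5-d5), `cor25_ofSpecialFibre`,
`prop24iii_ofSpecialFibre` (abc-iut-L5-t11).  Conjuncts = the typed node predicates AT the datum.  Nothing here asserts that abc
is proved or refuted or takes a side on [IUTchIII] Cor. 3.12; a binder is an assumption label; typed ≠ discharged. -/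
theorem layer5_held_sec2
    {p : ℕ} [Fact p.Prime] (X : TemperedCurve p) (d : X.GroupLevelData)
    (S : SpecialFibreData (X.toTemperedArithmeticGroup d)) (h36 : S.Gc.Prop36Hypotheses)
    (Sigma SigmaHat : Set ℕ) (hsub : Sigma ⊆ SigmaHat) (hne : Sigma.Nonempty)
    (hprime : ∀ q ∈ SigmaHat, q.Prime) (hp : p ∉ Sigma) (TpH : Subgroup S.chart.G)
    (HatH : Subgroup (TemperedGraphGroupData.exists_completion_of_prop36 S.Gc h36 S.chart).choose)
    (hle : TpH.map (TemperedGraphGroupData.exists_completion_of_prop36 S.Gc h36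
      S.chart).choose_spec.choose.toMonoidHom ≤ HatH)
    (cuspMeetsH : {x : X.Pt // X.IsCusp x} → Prop) (x : {x : X.Pt // X.IsCusp x})
    (h22 : (StableCurveTemperedData.ofSpecialFibre X d S h36 Sigma SigmaHat hsub hne hprime hp TpH HatH hle
      cuspMeetsH).graph.CommensuratorsOfDecompositionSubgroups)
    (hH : ((StableCurveTemperedData.ofSpecialFibre X d S h36 Sigma SigmaHat hsub hne hprime hp TpH HatH hle cuspMeetsH).graph.HatH :
        Set (StableCurveTemperedData.ofSpecialFibre X d S h36 Sigma SigmaHat hsub hne hprime hp TpH HatH hle cuspMeetsH).graph.Hat) =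
      closure ((StableCurveTemperedData.ofSpecialFibre X d S h36 Sigma SigmaHat hsub hne hprime hp TpH HatH hle cuspMeetsH).graph.ι ''
        (StableCurveTemperedData.ofSpecialFibre X d S h36 Sigma SigmaHat hsub hne hprime hp TpH HatH hle cuspMeetsH).graph.TpH))
    (hker : ((StableCurveTemperedData.ofSpecialFibre X d S h36 Sigma SigmaHat hsub hne hprime hp TpH HatH hle cuspMeetsH).ρHat.ker :
        Set (StableCurveTemperedData.ofSpecialFibre X d S h36 Sigma SigmaHat hsub hne hprime hp TpH HatH hle cuspMeetsH).DeltaHat) ⊆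
      closure (((StableCurveTemperedData.ofSpecialFibre X d S h36 Sigma SigmaHat hsub hne hprime hp TpH HatH hle cuspMeetsH).ιΔ.range :
          Set (StableCurveTemperedData.ofSpecialFibre X d S h36 Sigma SigmaHat hsub hne hprime hp TpH HatH hle cuspMeetsH).DeltaHat) ∩
        ((StableCurveTemperedData.ofSpecialFibre X d S h36 Sigma SigmaHat hsub hne hprime hp TpH HatH hle cuspMeetsH).ρHat.ker :
          Set (StableCurveTemperedData.ofSpecialFibre X d S h36 Sigma SigmaHat hsub hne hprime hp TpH HatH hle cuspMeetsH).DeltaHat)))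
    (hOutTp : ∀ g : (StableCurveTemperedData.ofSpecialFibre X d S h36 Sigma SigmaHat hsub hne hprime hp TpH HatH hle cuspMeetsH).PiTp,
      ∃ δ : (StableCurveTemperedData.ofSpecialFibre X d S h36 Sigma SigmaHat hsub hne hprime hp TpH HatH hle cuspMeetsH).DeltaTp,
        MulAut.conj g • ((StableCurveTemperedData.ofSpecialFibre X d S h36 Sigma SigmaHat hsub hne hprime hp TpH HatH hle
            cuspMeetsH).deltaTpH.map
          (StableCurveTemperedData.ofSpecialFibre X d S h36 Sigma SigmaHat hsub hne hprime hp TpH HatH hle cuspMeetsH).DeltaTp.subtype) =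
        MulAut.conj (δ : (StableCurveTemperedData.ofSpecialFibre X d S h36 Sigma SigmaHat hsub hne hprime hp TpH HatH hle
            cuspMeetsH).PiTp) •
          ((StableCurveTemperedData.ofSpecialFibre X d S h36 Sigma SigmaHat hsub hne hprime hp TpH HatH hle cuspMeetsH).deltaTpH.map
            (StableCurveTemperedData.ofSpecialFibre X d S h36 Sigma SigmaHat hsub hne hprime hp TpH HatH hle cuspMeetsH).DeltaTp.subtype))
    (hOutHat : ∀ γ : (StableCurveTemperedData.ofSpecialFibre X d S h36 Sigma SigmaHat hsub hne hprime hp TpH HatH hle cuspMeetsH).PiHat,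
      ∃ δ : (StableCurveTemperedData.ofSpecialFibre X d S h36 Sigma SigmaHat hsub hne hprime hp TpH HatH hle cuspMeetsH).DeltaHat,
        MulAut.conj γ • ((StableCurveTemperedData.ofSpecialFibre X d S h36 Sigma SigmaHat hsub hne hprime hp TpH HatH hle
            cuspMeetsH).deltaHatH.map
          (StableCurveTemperedData.ofSpecialFibre X d S h36 Sigma SigmaHat hsub hne hprime hp TpH HatH hle cuspMeetsH).DeltaHat.subtype) =
        MulAut.conj (δ : (StableCurveTemperedData.ofSpecialFibre X d S h36 Sigma SigmaHat hsub hne hprime hp TpH HatH hle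
            cuspMeetsH).PiHat) •
          ((StableCurveTemperedData.ofSpecialFibre X d S h36 Sigma SigmaHat hsub hne hprime hp TpH HatH hle cuspMeetsH).deltaHatH.map
            (StableCurveTemperedData.ofSpecialFibre X d S h36 Sigma SigmaHat hsub hne hprime hp TpH HatH hle cuspMeetsH).DeltaHat.subtype))
    {I : Type*}
    (J : I → Subgroup (StableCurveTemperedData.ofSpecialFibre X d S h36 Sigma SigmaHat hsub hne hprime hp TpH HatH hle cuspMeetsH).DeltaHat)
    (hcof : ∀ W : Subgroup (StableCurveTemperedData.ofSpecialFibre X d S h36 Sigma SigmaHat hsub hne hprime hp TpH HatH hle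
        cuspMeetsH).DeltaHat,
      W.Normal → IsOpen (W : Set (StableCurveTemperedData.ofSpecialFibre X d S h36 Sigma SigmaHat hsub hne hprime hp TpH HatH hle
        cuspMeetsH).DeltaHat) → ∃ i, J i ≤ W)
    (hA : (∃ l ∈ SigmaHat, l ∉ Sigma ∧ l ≠ p) →
      ∀ i (a : (StableCurveTemperedData.ofSpecialFibre X d S h36 Sigma SigmaHat hsub hne hprime hp TpH HatH hle cuspMeetsH).DeltaHat),
        (∀ x ∈ J i, x ∈ (StableCurveTemperedData.ofSpecialFibre X d S h36 Sigma SigmaHat hsub hne hprime hp TpH HatH hle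
          cuspMeetsH).ρHat.ker → a * x = x * a) → a ∈ J i)
    (hB : SigmaHat = {q | q.Prime} →
      ∀ i (a : (StableCurveTemperedData.ofSpecialFibre X d S h36 Sigma SigmaHat hsub hne hprime hp TpH HatH hle cuspMeetsH).DeltaHat),
        (∀ x ∈ J i, x ∈ (StableCurveTemperedData.ofSpecialFibre X d S h36 Sigma SigmaHat hsub hne hprime hp TpH HatH hle
          cuspMeetsH).ρHat.ker → a * x = x * a) → a ∈ J i)
    (hv : ((StableCurveTemperedData.ofSpecialFibre X d S h36 Sigma SigmaHat hsub hne hprime hp TpH HatH hle cuspMeetsH).graph.HatH : Set (StableCurveTemperedData.ofSpecialFibre X d S h36 Sigma SigmaHat hsub hne hprime hp TpH HatH hle cuspMeetsH).graph.Hat) ∩ Set.range (StableCurveTemperedData.ofSpecialFibre X d S h36 Sigma SigmaHat hsub hne hprime hp TpH HatH hle cuspMeetsH).graph.ι =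
      (StableCurveTemperedData.ofSpecialFibre X d S h36 Sigma SigmaHat hsub hne hprime hp TpH HatH hle cuspMeetsH).graph.ι '' (StableCurveTemperedData.ofSpecialFibre X d S h36 Sigma SigmaHat hsub hne hprime hp TpH HatH hle cuspMeetsH).graph.TpH)
    (htp : ∀ x : (StableCurveTemperedData.ofSpecialFibre X d S h36 Sigma SigmaHat hsub hne hprime hp TpH HatH hle cuspMeetsH).Cusp, (StableCurveTemperedData.ofSpecialFibre X d S h36 Sigma SigmaHat hsub hne hprime hp TpH HatH hle cuspMeetsH).cuspMeetsH x →
      ∃ t : (StableCurveTemperedData.ofSpecialFibre X d S h36 Sigma SigmaHat hsub hne hprime hp TpH HatH hle cuspMeetsH).graph.Tp, ((StableCurveTemperedData.ofSpecialFibre X d S h36 Sigma SigmaHat hsub hne hprime hp TpH HatH hle cuspMeetsH).inertiaTp x).map (StableCurveTemperedData.ofSpecialFibre X d S h36 Sigma SigmaHat hsub hne hprime hp TpH HatH hle cuspMeetsH).ρTp ≤ MulAut.conj t • (StableCurveTemperedData.ofSpecialFibre X d S h36 Sigma SigmaHat hsub hne hprime hp TpH HatH hle cuspMeetsH).graph.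TpH)
    (hhat : ∀ x : (StableCurveTemperedData.ofSpecialFibre X d S h36 Sigma SigmaHat hsub hne hprime hp TpH HatH hle cuspMeetsH).Cusp,
      (∃ g : (StableCurveTemperedData.ofSpecialFibre X d S h36 Sigma SigmaHat hsub hne hprime hp TpH HatH hle cuspMeetsH).graph.Hat, (((StableCurveTemperedData.ofSpecialFibre X d S h36 Sigma SigmaHat hsub hne hprime hp TpH HatH hle cuspMeetsH).inertiaTp x).map (StableCurveTemperedData.ofSpecialFibre X d S h36 Sigma SigmaHat hsub hne hprime hp TpH HatH hle cuspMeetsH).ρTp).map (StableCurveTemperedData.ofSpecialFibre X d S h36 Sigma SigmaHat hsub hne hprime hp TpH HatH hle cuspMeetsH).graph.ι ≤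
        MulAut.conj g • (StableCurveTemperedData.ofSpecialFibre X d S h36 Sigma SigmaHat hsub hne hprime hp TpH HatH hle cuspMeetsH).graph.HatH) → (StableCurveTemperedData.ofSpecialFibre X d S h36 Sigma SigmaHat hsub hne hprime hp TpH HatH hle cuspMeetsH).cuspMeetsH x)
    (h24i : (StableCurveTemperedData.ofSpecialFibre X d S h36 Sigma SigmaHat hsub hne hprime hp TpH HatH hle cuspMeetsH).Prop24i)
    (h24ii : (StableCurveTemperedData.ofSpecialFibre X d S h36 Sigma SigmaHat hsub hne hprime hp TpH HatH hle cuspMeetsH).Prop24ii) :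
    (StableCurveTemperedData.ofSpecialFibre X d S h36 Sigma SigmaHat hsub hne hprime hp TpH HatH hle cuspMeetsH).Cor23i ∧  -- IUTchI:Cor2.3(i)
    (StableCurveTemperedData.ofSpecialFibre X d S h36 Sigma SigmaHat hsub hne hprime hp TpH HatH hle cuspMeetsH).Cor23ii ∧  -- IUTchI:Cor2.3(ii)
    (StableCurveTemperedData.ofSpecialFibre X d S h36 Sigma SigmaHat hsub hne hprime hp TpH HatH hle cuspMeetsH).Cor23iii ∧  -- IUTchI:Cor2.3(iii)
    (StableCurveTemperedData.ofSpecialFibre X d S h36 Sigma SigmaHat hsub hne hprime hp TpH HatH hle cuspMeetsH).Cor23iv ∧  -- IUTchI:Cor2.3(iv)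
    (StableCurveTemperedData.ofSpecialFibre X d S h36 Sigma SigmaHat hsub hne hprime hp TpH HatH hle cuspMeetsH).Cor23v ∧  -- IUTchI:Cor2.3(v)
    (StableCurveTemperedData.ofSpecialFibre X d S h36 Sigma SigmaHat hsub hne hprime hp TpH HatH hle cuspMeetsH).Cor23vi ∧  -- IUTchI:Cor2.3(vi)
    ((StableCurveTemperedData.ofSpecialFibre X d S h36 Sigma SigmaHat hsub hne hprime hp TpH HatH hle cuspMeetsH).Cor25Decomposition ∧  -- IUTchI:Cor2.5 (index name `N_IUTchI_Cor2_5`)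
      (StableCurveTemperedData.ofSpecialFibre X d S h36 Sigma SigmaHat hsub hne hprime hp TpH HatH hle cuspMeetsH).Cor25Inertia) ∧  -- IUTchI:Cor2.5, inertia part (Rmk 2.5.2)
    (StableCurveTemperedData.ofSpecialFibre X d S h36 Sigma SigmaHat hsub hne hprime hp TpH HatH hle cuspMeetsH).Prop24iii :=  -- IUTchI:Prop2.4(iii) at the datum (lead D2; not one of the 139 cone rows)
  haveI : Nonempty X.Pt := ⟨x.1⟩
  haveI : Nonempty {x : X.Pt // X.IsCusp x} := ⟨x⟩
  have h14 := StableCurveTemperedData.cor23_i_to_iv_ofSpecialFibre X d S h36 Sigma SigmaHat hsub hne hprime hp TpH HatH hle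
    cuspMeetsH h22 hH hker hOutTp hOutHat J hcof hA hB
  ⟨h14.1, h14.2.1, h14.2.2.1, h14.2.2.2, (StableCurveTemperedData.ofSpecialFibre X d S h36 Sigma SigmaHat hsub hne hprime hp TpH HatH hle cuspMeetsH).cor23v_of_graph hv,
    (StableCurveTemperedData.ofSpecialFibre X d S h36 Sigma SigmaHat hsub hne hprime hp TpH HatH hle cuspMeetsH).cor23vi_of_graph htp hhat,
    StableCurveTemperedData.cor25_ofSpecialFibre X d S h36 Sigma SigmaHat hsub hne hprime hp TpH HatH hle cuspMeetsH h24i h24ii,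
    StableCurveTemperedData.prop24iii_ofSpecialFibre X d S h36 Sigma SigmaHat hsub hne hprime hp TpH HatH hle cuspMeetsH x h24i⟩

/-- **Class (c), [IUTchI] §6 — HELD rows Prop 6.5 (i), 6.6 (ii), 6.6 (iii), 6.8 (i) (NODE RULE #17 (β)), KIT-RELATIVE.**  DATA binder
`K : PMBaseKit l` is a NAMED INTERFACE DATA ATOM, not the genuine kit: the genuine P5-binding kit is not yet a term in the tree (D13 in
flight: abc-iut-L5-t4 PiAvatar*, abc-iut-L5-t3 KitNFSide*).  ONE LAW binder for all four rows (and Rmk 6.12.1):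
`hβ : PMBaseKit.Ex63.NegCompatModel K` ([IUTchI] Ex 6.3 (ii) p. 161, the `[−1]`-compatibility of `φ^{Θell}_{•,v}`; genuine-object form
= abc-iut-L5-t13's `Ex63.negCompatModel_of_fixes` over the P5-binding).  Closers BY NAME: 6.5 (i) first sentence UNCONDITIONAL
(`DThetaEllBridge.inducesZeta`, abc-iut-L5-t4), second sentence `DThetaEllBridge.xiGroupCompat_of_negCompatModel` (abc-iut-L5-t13 p420660;
(α) `Ex63.PhiEllSync` follows from (β), `Ex63.phiEllSync_of_negCompatModel`, so it is no separate binder; `hl : l ≠ 2` is its side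
condition) · 6.6 (ii)/(iii) `DThetaEllBridge.isoTorsor_of_negCompatModel` / `DThetaPMEllHT.isoTorsor_of_negCompatModel` · 6.8 (i)
`DThetaPMEllHT.ellBridgeSymmetry_of_negCompatModel` (abc-iut-w5-d086 p414098).  Conjuncts = the TYPED node statements (the index abbrevs
`N_IUTchI_Prop6_6_ii/iii` point at `DThetaPMBridge.IsoTorsor` by locator matching — 6.6 (i), discharged unconditionally); the untyped
printed clause of 6.8 (i) («a finite group with a natural outer isomorphism to `𝔽_l^{⋊±}`», sub-DAG P68i-L03/L04) is not claimed.
Nothing here asserts that abc is proved or refuted or takes a side on [IUTchIII] Cor. 3.12; a binder is an assumption label. -/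
theorem layer5_held_sec6 {l : ℕ} [Fact l.Prime] (hl : l ≠ 2) (K : PMBaseKit l)
    (hβ : PMBaseKit.Ex63.NegCompatModel K) :
    ((∀ B : K.DThetaEllBridge, B.InducesZeta) ∧ ∀ B : K.DThetaEllBridge, B.XiGroupCompat) ∧  -- IUTchI:Prop6.5(i)
    (∀ B₁ B₂ : K.DThetaEllBridge, PMBaseKit.DThetaEllBridge.IsoTorsor B₁ B₂) ∧  -- IUTchI:Prop6.6(ii)
    (∀ H₁ H₂ : K.DThetaPMEllHT, PMBaseKit.DThetaPMEllHT.IsoTorsor H₁ H₂) ∧  -- IUTchI:Prop6.6(iii)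
    (∀ H : K.DThetaPMEllHT, PMBaseKit.DThetaPMEllHT.EllBridgeSymmetry H) :=  -- IUTchI:Prop6.8(i)
  ⟨⟨fun B => PMBaseKit.DThetaEllBridge.inducesZeta B,
    fun B => PMBaseKit.DThetaEllBridge.xiGroupCompat_of_negCompatModel hl hβ B⟩,
   PMBaseKit.DThetaEllBridge.isoTorsor_of_negCompatModel hβ,
   PMBaseKit.DThetaPMEllHT.isoTorsor_of_negCompatModel hβ,
   PMBaseKit.DThetaPMEllHT.ellBridgeSymmetry_of_negCompatModel hβ⟩

/-- **Class (c), [IUTchI] §6 — HELD row Prop 6.7 (NODE RULE #17 (γ)).**  DATA binders (interface atoms): a §4 base datum `𝔡 : BaseThetaDatum`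
(abc-iut-L5-t3), a kit `K : PMBaseKit 𝔡.l` core-agreeing with it (`c : 𝔡.KitCore K`, Def 6.1 (i)), `M : K.MultKit`, `hl : Odd 𝔡.l`.
LAW binder `hγ : c.ThetaAgrees M` (Prop 6.7 p. 167: the poly-morphisms at `v ∈ 𝕍^bad` are "the poly-morphisms described in
Example 4.4 (i), (ii)").  Closer BY NAME: abc-iut-L5-t3's `BaseThetaDatum.KitCore.thetaBridgeAlgorithm_dThetaBridge` (p417112, sub-DAG
P67-L05).  Conjunct = abc-iut-L5-t4's named statement `DThetaPMBridge.ThetaBridgeAlgorithm M P hl` at `P D :=` "`D` is, through the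
dictionary, isomorphic to a `𝒟-Θ`-bridge of Definition 4.6 (ii)" (no kernel-index name at this regeneration).  Nothing here asserts
that abc is proved or refuted or takes a side on [IUTchIII] Cor. 3.12; a binder is an assumption label. -/
theorem layer5_held_prop67 {𝔡 : BaseThetaDatum} {K : PMBaseKit 𝔡.l} (c : 𝔡.KitCore K) (M : K.MultKit)
    (hl : Odd 𝔡.l) (hγ : c.ThetaAgrees M) :
    PMBaseKit.DThetaPMBridge.ThetaBridgeAlgorithm M
      (fun D => ∃ (B : 𝔡.DThetaBridge) (ι : D.J ≃ B.J)
          (κ : ∀ j x, (c.amb x).obj (B.capsule (ι j) (c.e x)) ≅ (D.capsule j).obj x)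
          (γ : ∀ x, (c.amb x).obj (B.cod (c.e x)) ≅ D.codomain.obj x),
          ∀ j x, D.poly j x =
            {g | ∃ f ∈ B.poly (ι j) (c.e x), g = (κ j x).inv ≫ (c.amb x).map f ≫ (γ x).hom})
      hl :=  -- IUTchI:Prop6.7
  BaseThetaDatum.KitCore.thetaBridgeAlgorithm_dThetaBridge hγ hl

/-- **Class (c), [IUTchI] §5 — HELD row Cor 5.6 (i), the FROZEN node statement `BaseThetaDatum.S5Local.Cor56i S`** (RULINGS #37 (3) token
reading).  DATA binders (interface atoms; the genuine Ex 3.5 `Glob` and the law there are abc-iut-w5-d217's theorem target): abc-iut-L5-t3's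
§5 local system `S : S5Local 𝔡` over a base datum `𝔡`, a kit core `c : 𝔡.KitCore K`, an `ℱ`-prime-strip kit `FK : K.FKit M` and its core
agreement `fc : S.FKitCore c FK`.  LAW / instance binders BY NAME: `he` (surjective place dictionary) · `h02 : FK.ThToFBijOnGood` ·
`h53ii : FK.IsomFtoDBijective` (Cor 5.3 (ii)) · `h53iv : FK.AutTemperedBijective` (Cor 5.3 (iv)) · `hfaith : FK.RlfIsoFaithful` (⇐
`ComponentIsoInjective` at the genuine `Glob`, Rmk 5.2.1 (ii); GAP G-w5d217-1) · `hnat : FK.RlfOfNatural` ((ε) functoriality) ·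
`hcan : ∀ H, (H : FK.ThetaHT).IsCanonical` ((ε) for every kit theater — the ALL-BUILT route: equivalent, given `hnat`, to (ε) at the
reference theater alone by abc-iut-w5-d217's `FKitCore.isCanonical_ht_of_ref` in `FKitCoreBridgeCanonical.lean` p427470/p428577, whose olean
was not yet available when this module was filed — the equivalence of record; `hcan` is the (ε)-class law «every Θ-Hodge theater of the
ℱ-kit is canonically framed» (the `CanonicalRlf` reading) and `hHT` its reference-theater form; abc-iut-L5-lead ruling (F1) 07:23:09Z).
Closers BY NAME (BUILT modules): abc-iut-L5-t3's `S5Local.FKitCore.cor56i_of_cor56iKit` (FKitCoreBridge p417964) ∘ abc-iut-w5-d217's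
`PMBaseKit.FKit.cor56iKit_of_injective_of_canonical` (HodgeTheaterModelFKitCor56iLaws p424893, the literal closer of RULINGS #33 (3)).
Nothing here asserts that abc is proved or refuted or takes a side on [IUTchIII] Cor. 3.12. -/
theorem layer5_held_cor56i {𝔡 : BaseThetaDatum} (S : BaseThetaDatum.S5Local 𝔡) {K : PMBaseKit 𝔡.l} {c : 𝔡.KitCore K}
    {M : K.MultKit} {FK : K.FKit M} (fc : S.FKitCore c FK) (he : Function.Surjective c.e)
    (h02 : FK.ThToFBijOnGood) (h53ii : FK.IsomFtoDBijective) (h53iv : FK.AutTemperedBijective)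
    (hfaith : FK.RlfIsoFaithful) (hnat : FK.RlfOfNatural) (hcan : ∀ H : FK.ThetaHT, H.IsCanonical) :
    BaseThetaDatum.S5Local.Cor56i S :=  -- IUTchI:Cor5.6(i)
  fc.cor56i_of_cor56iKit he (PMBaseKit.FKit.cor56iKit_of_injective_of_canonical h02 h53ii h53iv hfaith hnat hcan) h53ii

/-- **THE LAYER-5 CERTIFICATE v0** (plan/C/ABC-OF-S-SPEC.md §3; lead D4): the conjunction of the four DISCHARGED-section statements and the
four HELD-block statements of this module (the fifth, `layer5_held_cor12`, lives in the companion `Conditional/Layer5OfSData.lean`) (each BY NAME via `StatementOf`; the held blocks carry their DATA and LAW binders explicitly — 28 Prop binders in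
all, L5's scoreboard: see the census in the module docstring).  S-FREE.  Nothing here asserts that abc is proved or refuted or takes a
side on [IUTchIII] Cor. 3.12; a binder is an assumption label; typed ≠ discharged; indexed ≠ endorsed. -/
theorem layer5_of_S :
    StatementOf @layer5_discharged_sec3 ∧ StatementOf @layer5_discharged_sec4 ∧
    StatementOf @layer5_discharged_sec5 ∧ StatementOf @layer5_discharged_sec6 ∧
    StatementOf @layer5_held_sec2 ∧ StatementOf @layer5_held_sec6 ∧ StatementOf @layer5_held_prop67 ∧
    StatementOf @layer5_held_cor56i :=
  ⟨@layer5_discharged_sec3, @layer5_discharged_sec4, @layer5_discharged_sec5, @layer5_discharged_sec6,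
    @layer5_held_sec2, @layer5_held_sec6, @layer5_held_prop67, @layer5_held_cor56i⟩

end Summit.ABC.IUTFork.Conditional
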